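import Summits.QuantumFields.BalabanUV.Beta.GAN24.T2SlavedDivergence
import Summits.QuantumFields.BalabanUV.Beta.GAN24.Lin4ParityCovariance

/-!
# `BalabanUV.Beta.GAN24.HalfMemberSlavedDivergence` — binder row G-an2-4 ∕ (CONV-C), W-slot EXIT (α) (RULING R-lead-g77-1 (2); the OWNER gan24-p1 g33's
# RULING R-gan24p1-g33-1 + A1 and his located ask W9 l.49725 **(α-END-b1) «THE EVEN MEMBER's SLAVED DIVERGENCE»**): leaf-06's SLAVE-src
# (`T2SlavedDivergence`) PROJECTED BY THE SLOTWISE PARITY `P := sgnK ∘ trK` — **THE SOURCE-SLOT DIVERGENCE OF THE `ε`-MEMBER `y_j := ½ • (T♮̃_j + ε • P T♮̃_j)` OF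
# an2's DRESSED COMB TOWER ONE LEVEL UP IS SLAVED TO LEVEL-`j` FIRST-ORDER DATA, AND THE PARITIES OF THE TABLE LAW's LETTERS SPLIT IT: AT `ε = 1` (THE EVEN MEMBER)
# THE REMAINDER `R` IS GONE, AT `ε = −1` (THE ODD MEMBER) THE COMMUTATOR IS GONE**
# (G-an2-4 FORMAL swarm → CRUX TEAM (2), leaf-01 lineage `b2b-balaban-gan24-formalise-leaf-01`, gen 72)

NOT IN PRINT; OUR BOOKKEEPING ([folklore] compositions BY NAME over EXISTING objects; 0 `def`, 0 cited facts, 0 `def … : Prop`, 0 sorry).  HONEST FRAMING (cell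
contract, verbatim): «discharging `BetaPertH` makes Bałaban's UV stability UNCONDITIONAL — a real constructive-QFT result; it is NOT the continuum limit and NOT
the Clay problem.»  HONEST DEPENDENCY (verbatim): «continuum YM on T⁴ ⇐ BetaPertH ∧ nine spine estimates (0/9 proved); BetaPertH ⇐ (D1) ∧ (D4) ∧ CAP+tail;
G-an2-4 gates asym, D1 and NE2/3/4.»

WHAT (objects EXACTLY as in leaf-06's `T2SlavedDivergence` and in the (α-END) files: comb literal `T̃_j := T2RecAt d Lc (toSite r) cE cVH cΛ cE₂ cB Tc vh₂S (mixFFAt ρ Lc) j`,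
unit member `T♮̃_j := unitS₂ (sfStep Lc j) (smStep d Lc j) T̃_j`, dressed unit kernel `K♮ᴱ_j := unitK_j (coDressKBmAt ρ Lc (KInvStep Lc j))`, `c₄ := cE₂·Lc^{2(d+1)}`, p2's
(F1) dressed source `b♮̃_j` (NO member inside), the slotwise parity `P T κ u κ′ u′ := sgnK (trK (T κ u κ′ u′))`, the `ε`-member `y_j := ½ • (T♮̃_j + ε • P T♮̃_j)` in the
END's spelling (`ε = 1`: the EVEN member, `ε = −1`: the ODD member); in-block root, `1 ≤ Lc`, an1's border data `hBff hBmm hB`; generic `d`, all constants symbolic):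
* §0 parity ∕ unit plumbing ([folklore]): `sgnK_trK_boxSum_divV_fst ∕ _snd` (`P` commutes with the block-summed slot divergences), `boxSum_divV_fst_half ∕ _snd_half`
  (the block-summed slot divergences of `½ • (U + ε • P U)` are `½ • (F + ε • P F)`), `sgnK_trK_unitS` (`P` passes the first-order unit rescaling).
* §1 **`halfMember_succ_eq`** (the `ε`-member's ONE-STEP RECURSION `y_{j+1} = 𝒜^Ĝ_j y_j + ½ • (b♮̃_j + ε • P b♮̃_j)`), `bdd₄_halfMember`, and
  **`divW_halfMember_succ_eq`** — T-EQ ON THE `ε`-MEMBER, HYPOTHESIS-FREE: `divW (y_{j+1}) y ν y′ = divW (½ • (b♮̃_j + ε • P b♮̃_j)) y ν y′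
  + (c₄·(Lc^{d+1})⁻¹∕2) • (e3OfK Lc K♮ᴱ_j F₁^{ε} ν y′ + e3OfK Lc K♮ᴱ_j F₂^{ε} ν y′)`, `F₁^{ε} ∕ F₂^{ε}` the two block-summed slot divergences of `y_j` — the one-step
  recursion of the `ε`-member `y_{j+1} = 𝒜^Ĝ_j y_j + ½ • (b♮̃_j + ε • P b♮̃_j)` (p2's (F1) step at the comb letters ⨾ MY `Lin4ParityCovariance.sgnK_trK_lin4_unitK_coDress` ⨾
  `lin4_smul ∕ lin4_add_of_bdd₄`) then leaf-03 g58's T-EQ `Lin4SlotDivergence.divW_lin4_comb` on the BOUNDED table `y_j` + leaf-06's `divW_add_apply`; NO commutation of `P`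
  with `e3OfK` is used.
* §2 **`boxSum_divV_half_fst_of_tableLaw ∕ _snd_of_tableLaw`** — THE `ε`-MEMBER's BLOCK-SUMMED SLOT DIVERGENCE SLAVED BY A RAW TABLE LAW WITH PARITIES (letters `S X R cH′`,
  `cH′ ≠ 0`; the law in the LITERAL conclusion shape of D1's `WardLocusQuarticTable.tableLaw_T2RecAt_succ ∕ _zero` exactly as leaf-06's `boxSum_divV_unitS₂_fst_of_tableLaw`;
  parity letters `hC` — the commutator word `S κ u ∘ X Y − X Y ∘ S κ u` is parity-EVEN — and `hR` — the remainder `R Y κ u` is parity-ODD):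
  `Σ_{v∈box} divV (κ u ↦ y κ u κ′ u′) (Lc•y + v) = (sf·sm)⁻¹ • unitS sf sm (κ′ u′ ↦ cH′⁻¹ • (((1+ε)∕2) • (S κ′ u′ ∘ X y − X y ∘ S κ′ u′) + ((1−ε)∕2) • R y κ′ u′)) κ′ u′`
  (leaf-06's §2 ⨾ §0 ⨾ leaf-03 g65's `parityEven_iff ∕ parityOdd_iff`); `hC` for `X Y = diagK (g Y)` and odd-rowed `S` is leaf-03 g64's
  `LayerCommutatorAntisymm.trK_comm_diagK_of_sgnAntisymm` BY NAME (`parityEven_comm_of_oddRows`).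
* PART 2 (`GAN24/HalfMemberSlavedDivergenceComb`, same author): §3 `divW_halfMember_succ_eq_slaved` = §1 ∘ §2 for the comb member under the two RAW table laws (letters
  `S X R R″ cH′`, parities `hC hR hR″`) and the two named members `divW_evenMember_succ_eq_slaved` (`ε = 1`: NO `R` — the OWNER's sentence «the commutator is EVEN, `R` is
  ODD») ∕ `divW_oddMember_succ_eq_slaved` (`ε = −1`: NO commutator, PURE RESIDUAL).
What (α-END-b) still needs downstream (NOT here): the window step (leaf-02's `SlotDivergenceLetters` ∕ `SlotDefectWindowShapes` on §3's two summands) and (Q-L), giving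
the END's displayed `hcell`; the instances at D1's literal table laws need the literal letters' parities (`S` odd-rowed: leaf-05; `R` odd: p2 `WardResidualParity` §3 for the
`𝒩`-word, the border remainder by its own letter).  Asserts NOTHING about Bałaban's tables; 0 estimate; the table laws and parities are LETTERS; discharges NOTHING of
`hcell` ∕ (Q-L) ∕ (C) ∕ «T2Shape» ∕ «T2Drift» ∕ (hW, hWall); (β) of record untouched; NEVER «G-an2-4 closed» as (CONV-C); NOT D1, NOT `BetaPertH`, NOT continuum, NOT
Clay.  2026-08-23.
-/

noncomputable section

open Finset
open scoped BigOperators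
open Literature.MathematicalPhysics.QuantumFieldTheory
open Literature.MathematicalPhysics.QuantumFieldTheory.Balaban1983to89
open Literature.MathematicalPhysics.QuantumFieldTheory.Balaban1983to89.Beta
open ExpKernelCalculus (MKer Decays comp)
open OneStepResolventKernel (Fib)
open OneStepKernelFamily (KInvStep)
open SecondOrderResponse (W2SymOfK)
open BalabanStepJetsSucc (mmRead)
open BalabanStepW2 (K3OfK M2Of)
open KernelWard (divV divW)
open AffineAveraging (box toSite)
open BalabanCompositeJets (LocStencil₂)
open AveragingMixedJetTables (mixFFAt)
open Summit.QuantumFields.BalabanUV.Beta.TameKernelCalculus (trK trK_apply)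
open Summit.QuantumFields.BalabanUV.Beta.BorderedHessian (sgnK sgnK_apply diagK)
open Summit.QuantumFields.BalabanUV.Beta.HessKerDressedUnits (unitK unitS unitS_apply decays_unitK)
open Summit.QuantumFields.BalabanUV.Beta.SecondOrderUnits (unitM unitS₂ unitM₂)
open Summit.QuantumFields.BalabanUV.Beta.AxialDressingRooted (coDressKBmAt decays_coDressKBmAt_KInvStep)
open Summit.QuantumFields.BalabanUV.Beta.SpineRooted (T2RecOf T2RecAt SpureRecAt M1At T2RecOf_comb e3OfK locStencil_SpureRecAt vertexFamily_M1At)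
open Summit.QuantumFields.BalabanUV.Beta.MixedJetTablesPlug (hmix_an1)
open Summit.QuantumFields.BalabanUV.Beta.GAN24.CombesThomas (sfStep smStep)
open Summit.QuantumFields.BalabanUV.Beta.GAN24.T2RecursionAffine (lin4)
open Summit.QuantumFields.BalabanUV.Beta.GAN24.BiStencilZeroMode (Tab)
open Summit.QuantumFields.BalabanUV.Beta.GAN24.Lin4ZeroMode (bdd_of_locStencil₂)
open Summit.QuantumFields.BalabanUV.Beta.GAN24.Lin4Additive (lin4_smul)
open Summit.QuantumFields.BalabanUV.Beta.GAN24.T2UnitSplitLevels (bdd₄_add lin4_add_of_bdd₄)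
open Summit.QuantumFields.BalabanUV.Beta.GAN24.T2RecOfUnitSplit (unitS₂_T2RecOf_succ_eq_lin4_add step_data_of_letters)
open Summit.QuantumFields.BalabanUV.Beta.GAN24.T2RecChargeStep (shape_member)
open Summit.QuantumFields.BalabanUV.Beta.GAN24.Lin4SlotDivergence (divW_lin4_comb)
open Summit.QuantumFields.BalabanUV.Beta.GAN24.T2SlavedDivergence (divW_add_apply boxSum_divV_unitS₂_fst_of_tableLaw boxSum_divV_unitS₂_snd_of_tableLaw)
open Summit.QuantumFields.BalabanUV.Beta.GAN24.SecondOrderReadersParity (sgnK_trK_add sgnK_trK_smul parityEven_iff parityOdd_iff)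
open Summit.QuantumFields.BalabanUV.Beta.GAN24.AffineUnrollProjected (bdd₄_parity parity_add bdd₄_smul)
open Summit.QuantumFields.BalabanUV.Beta.GAN24.LayerCommutatorAntisymm (trK_comm_diagK_of_sgnAntisymm)
open Summit.QuantumFields.BalabanUV.Beta.GAN24.Lin4ParityCovariance (sgnK_trK_lin4_unitK_coDress)

namespace Summit.QuantumFields.BalabanUV.Beta.GAN24.HalfMemberSlavedDivergence

variable {d : ℕ} {Lc : ℕ} [NeZero Lc] {r : Fin (d + 1) → ℕ}

/-! ## §0 Parity and unit plumbing for slot divergences -/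

section Plumbing

/-- [folklore] **THE SLOTWISE PARITY COMMUTES WITH THE BLOCK-SUMMED FIRST-SLOT DIVERGENCE** (a finite signed sum over the slot index; p2's `sgnK_trK_divW` pattern). -/
theorem sgnK_trK_boxSum_divV_fst (U : Tab d) (s : Finset (Fin (d + 1) → ℕ)) (p : (Fin (d + 1) → ℕ) → (Fin (d + 1) → ℤ))
    (κ' : Fin (d + 1)) (u' : Fin (d + 1) → ℤ) :
    sgnK (trK (∑ v ∈ s, divV (fun κ u => U κ u κ' u') (p v))) = ∑ v ∈ s, divV (fun κ u => sgnK (trK (U κ u κ' u'))) (p v) := by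
  funext x z a b
  simp only [KernelWard.divV, sgnK_apply, trK_apply, Finset.sum_apply, Pi.sub_apply, Finset.mul_sum, mul_sub]

/-- [folklore] **THE SLOTWISE PARITY COMMUTES WITH THE BLOCK-SUMMED SECOND-SLOT DIVERGENCE.** -/
theorem sgnK_trK_boxSum_divV_snd (U : Tab d) (s : Finset (Fin (d + 1) → ℕ)) (p : (Fin (d + 1) → ℕ) → (Fin (d + 1) → ℤ))
    (κ : Fin (d + 1)) (u : Fin (d + 1) → ℤ) :
    sgnK (trK (∑ v ∈ s, divV (U κ u) (p v))) = ∑ v ∈ s, divV (fun κ' u' => sgnK (trK (U κ u κ' u'))) (p v) := by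
  funext x z a b
  simp only [KernelWard.divV, sgnK_apply, trK_apply, Finset.sum_apply, Pi.sub_apply, Finset.mul_sum, mul_sub]

/-- [folklore] **THE BLOCK-SUMMED FIRST-SLOT DIVERGENCE OF THE `ε`-MEMBER `½ • (U + ε • P U)` IS `½ • (F + ε • P F)`**, `F` that of `U` (linearity + the commutation above). -/
theorem boxSum_divV_fst_half (U : Tab d) (ε : ℝ) (s : Finset (Fin (d + 1) → ℕ)) (p : (Fin (d + 1) → ℕ) → (Fin (d + 1) → ℤ))
    (κ' : Fin (d + 1)) (u' : Fin (d + 1) → ℤ) :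
    ∑ v ∈ s, divV (fun κ u => ((1 / 2 : ℝ) • (U + ε • fun κ u κ' u' => sgnK (trK (U κ u κ' u')))) κ u κ' u') (p v)
      = (1 / 2 : ℝ) • (∑ v ∈ s, divV (fun κ u => U κ u κ' u') (p v) + ε • sgnK (trK (∑ v ∈ s, divV (fun κ u => U κ u κ' u') (p v)))) := by
  rw [sgnK_trK_boxSum_divV_fst]
  funext x z a b
  simp only [KernelWard.divV, Finset.sum_apply, Pi.sub_apply, Pi.add_apply, Pi.smul_apply, smul_eq_mul, Finset.mul_sum,
    ← Finset.sum_add_distrib]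
  refine Finset.sum_congr rfl fun v _ => Finset.sum_congr rfl fun μ _ => ?_
  ring

/-- [folklore] **THE BLOCK-SUMMED SECOND-SLOT DIVERGENCE OF THE `ε`-MEMBER IS `½ • (F + ε • P F)`.** -/
theorem boxSum_divV_snd_half (U : Tab d) (ε : ℝ) (s : Finset (Fin (d + 1) → ℕ)) (p : (Fin (d + 1) → ℕ) → (Fin (d + 1) → ℤ))
    (κ : Fin (d + 1)) (u : Fin (d + 1) → ℤ) :
    ∑ v ∈ s, divV (((1 / 2 : ℝ) • (U + ε • fun κ u κ' u' => sgnK (trK (U κ u κ' u')))) κ u) (p v)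
      = (1 / 2 : ℝ) • (∑ v ∈ s, divV (U κ u) (p v) + ε • sgnK (trK (∑ v ∈ s, divV (U κ u) (p v)))) := by
  rw [sgnK_trK_boxSum_divV_snd]
  funext x z a b
  simp only [KernelWard.divV, Finset.sum_apply, Pi.sub_apply, Pi.add_apply, Pi.smul_apply, smul_eq_mul, Finset.mul_sum,
    ← Finset.sum_add_distrib]
  refine Finset.sum_congr rfl fun v _ => Finset.sum_congr rfl fun μ _ => ?_
  ring

/-- [folklore] **THE SLOTWISE PARITY PASSES THE FIRST-ORDER UNIT RESCALING** (`unitS sf sm` multiplies the entry `(x,z,a,b)` by a factor symmetric in `(a,b)`). -/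
theorem sgnK_trK_unitS (sf sm : ℝ) (F : Fin (d + 1) → (Fin (d + 1) → ℤ) → MKer (d + 1) (Fib d)) (κ : Fin (d + 1)) (u : Fin (d + 1) → ℤ) :
    sgnK (trK (unitS sf sm F κ u)) = unitS sf sm (fun κ u => sgnK (trK (F κ u))) κ u := by
  funext x z a b
  simp only [sgnK_apply, trK_apply, unitS_apply]
  ring

/-- [folklore] **THE COMMUTATOR WORD OF AN ODD-ROWED FIRST-ORDER TABLE WITH DIAGONAL GENERATORS IS PARITY-EVEN** — the letter `hC` of §2 for `X Y = diagK (g Y)`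
(leaf-03 g64's `LayerCommutatorAntisymm.trK_comm_diagK_of_sgnAntisymm`, row by row). -/
theorem parityEven_comm_of_oddRows {S : Fin (d + 1) → (Fin (d + 1) → ℤ) → MKer (d + 1) (Fib d)} (hS : ∀ κ u, trK (S κ u) = -sgnK (S κ u))
    (g : (Fin (d + 1) → ℤ) → (Fin (d + 1) → ℤ) → Fib d → ℝ) (Y : Fin (d + 1) → ℤ) (κ : Fin (d + 1)) (u : Fin (d + 1) → ℤ) :
    trK (comp (S κ u) (diagK (g Y)) - comp (diagK (g Y)) (S κ u)) = sgnK (comp (S κ u) (diagK (g Y)) - comp (diagK (g Y)) (S κ u)) :=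
  trK_comm_diagK_of_sgnAntisymm (hS κ u) (g Y)

end Plumbing

/-! ## §1 The one-step recursion of the `ε`-member and T-EQ on it (hypothesis-free) -/

section Member

/-- NOT IN PRINT; OUR BOOKKEEPING.  **THE ONE-STEP RECURSION OF THE `ε`-MEMBER** (every `ε j`; in-block root, `1 ≤ Lc`; an1's border data `hBff hBmm hB`):
`y_{j+1} = 𝒜^Ĝ_j y_j + ½ • (b♮̃_j + ε • P b♮̃_j)`, `y_j := ½ • (T♮̃_j + ε • P T♮̃_j)`, `𝒜^Ĝ_j := lin4 c₄ K♮ᴱ_j Lc` — p2's (F1) step at the comb letters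
(`step_data_of_letters` ⨾ `unitS₂_T2RecOf_succ_eq_lin4_add` ⨾ `T2RecOf_comb`), `P` through the dressed one-step map (MY `Lin4ParityCovariance.sgnK_trK_lin4_unitK_coDress`),
`lin4` linear on bounded tables (`lin4_smul ∕ lin4_add_of_bdd₄`; the member bounded by `shape_member` ⨾ `bdd_of_locStencil₂`). -/
theorem halfMember_succ_eq (hLc : 1 ≤ Lc) (hr : r ∈ box (d + 1) Lc) (cE cVH cΛ cE₂ cB : ℝ) (Tc : Fin 4 → Fin 4 → Fin 4 → Fin 4 → ℝ)
    {vh₂S : Tab d} (hBff : ∀ κ u κ' u' x z (α β : Fin (d + 1)), vh₂S κ u κ' u' x z (Sum.inl α) (Sum.inl β) = 0)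
    (hBmm : ∀ κ u κ' u' x z (μ ν : Fin (d + 1)), vh₂S κ u κ' u' x z (Sum.inr μ) (Sum.inr ν) = 0)
    (hB : ∃ C δ : ℝ, 0 < δ ∧ LocStencil₂ vh₂S C δ) (ε : ℝ) (j : ℕ) :
    ((1 / 2 : ℝ) • (unitS₂ (sfStep Lc (j + 1)) (smStep d Lc (j + 1)) (T2RecAt d Lc (toSite r) cE cVH cΛ cE₂ cB Tc vh₂S (mixFFAt (toSite r) Lc) (j + 1))
          + ε • fun κ u κ' u' => sgnK (trK (unitS₂ (sfStep Lc (j + 1)) (smStep d Lc (j + 1)) (T2RecAt d Lc (toSite r) cE cVH cΛ cE₂ cB Tc vh₂S (mixFFAt (toSite r) Lc) (j + 1)) κ u κ' u'))))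
      = lin4 (cE₂ * (Lc : ℝ) ^ (2 * (d + 1))) (unitK (sfStep Lc j) (smStep d Lc j) (coDressKBmAt (toSite r) Lc (KInvStep (d := d) Lc j))) Lc
          ((1 / 2 : ℝ) • (unitS₂ (sfStep Lc j) (smStep d Lc j) (T2RecAt d Lc (toSite r) cE cVH cΛ cE₂ cB Tc vh₂S (mixFFAt (toSite r) Lc) j)
          + ε • fun κ u κ' u' => sgnK (trK (unitS₂ (sfStep Lc j) (smStep d Lc j) (T2RecAt d Lc (toSite r) cE cVH cΛ cE₂ cB Tc vh₂S (mixFFAt (toSite r) Lc) j) κ u κ' u'))))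
        + ((1 / 2 : ℝ) • ((fun κ u κ' u' => (cE₂ * (Lc : ℝ) ^ (2 * (d + 1))) • mmRead Lc (K3OfK
            (unitK (sfStep Lc j) (smStep d Lc j) (coDressKBmAt (toSite r) Lc (KInvStep (d := d) Lc j))) Lc
            (unitS (sfStep Lc j) (smStep d Lc j) (SpureRecAt d Lc (toSite r) cE cVH cΛ j)) (unitM (sfStep Lc j) (smStep d Lc j) (M1At d Lc (toSite r) cΛ j))
            (W2SymOfK (unitK (sfStep Lc j) (smStep d Lc j) (coDressKBmAt (toSite r) Lc (KInvStep (d := d) Lc j))) Lc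
              (unitS (sfStep Lc j) (smStep d Lc j) (SpureRecAt d Lc (toSite r) cE cVH cΛ j)) (unitM (sfStep Lc j) (smStep d Lc j) (M1At d Lc (toSite r) cΛ j)) 0
              (unitM₂ (sfStep Lc j) (smStep d Lc j) (M2Of d Lc (mixFFAt (toSite r) Lc) j))) κ u κ' u') + cB • vh₂S κ u κ' u')
          + ε • fun κ u κ' u' => sgnK (trK ((fun κ u κ' u' => (cE₂ * (Lc : ℝ) ^ (2 * (d + 1))) • mmRead Lc (K3OfK
            (unitK (sfStep Lc j) (smStep d Lc j) (coDressKBmAt (toSite r) Lc (KInvStep (d := d) Lc j))) Lc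
            (unitS (sfStep Lc j) (smStep d Lc j) (SpureRecAt d Lc (toSite r) cE cVH cΛ j)) (unitM (sfStep Lc j) (smStep d Lc j) (M1At d Lc (toSite r) cΛ j))
            (W2SymOfK (unitK (sfStep Lc j) (smStep d Lc j) (coDressKBmAt (toSite r) Lc (KInvStep (d := d) Lc j))) Lc
              (unitS (sfStep Lc j) (smStep d Lc j) (SpureRecAt d Lc (toSite r) cE cVH cΛ j)) (unitM (sfStep Lc j) (smStep d Lc j) (M1At d Lc (toSite r) cΛ j)) 0
              (unitM₂ (sfStep Lc j) (smStep d Lc j) (M2Of d Lc (mixFFAt (toSite r) Lc) j))) κ u κ' u') + cB • vh₂S κ u κ' u') κ u κ' u')))) := by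
  -- p2's (F1) step at the comb letters: `T♮̃_{j+1} = 𝒜^Ĝ_j T♮̃_j + b♮̃_j`
  obtain ⟨C, δ, C₀, C₁, hδ, hK, h₀, hW⟩ := step_data_of_letters (fun j => coDressKBmAt (toSite r) Lc (KInvStep (d := d) Lc j))
      (SpureRecAt d Lc (toSite r) cE cVH cΛ) (M1At d Lc (toSite r) cΛ) cE₂ cB Tc hLc
      (fun j => decays_coDressKBmAt_KInvStep (d := d) hr j) (fun j => locStencil_SpureRecAt hLc hr cE cVH cΛ j)
      (fun j => ⟨_, 1, one_pos, vertexFamily_M1At hLc hr cΛ j zero_le_one⟩) hB (hmix_an1 hLc hr) j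
  have hstep := unitS₂_T2RecOf_succ_eq_lin4_add (fun j => coDressKBmAt (toSite r) Lc (KInvStep (d := d) Lc j))
      (SpureRecAt d Lc (toSite r) cE cVH cΛ) (M1At d Lc (toSite r) cΛ) cE₂ cB Tc vh₂S (mixFFAt (toSite r) Lc) hBff hBmm j hδ hK h₀ hW
  simp only [T2RecOf_comb] at hstep
  -- the member is bounded, and so is its parity image
  obtain ⟨CT, δT, hδT, hT⟩ := shape_member hLc hr cE cVH cΛ cE₂ cB Tc hB j
  have hbU : ∃ B : ℝ, ∀ κ u κ' u' x z a b,
      |unitS₂ (sfStep Lc j) (smStep d Lc j) (T2RecAt d Lc (toSite r) cE cVH cΛ cE₂ cB Tc vh₂S (mixFFAt (toSite r) Lc) j) κ u κ' u' x z a b| ≤ B :=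
    ⟨CT, bdd_of_locStencil₂ hT hδT.le⟩
  have hbP := bdd₄_smul ε (bdd₄_parity hbU)
  obtain ⟨δK, CK, hδK, -, hG⟩ := decays_coDressKBmAt_KInvStep (d := d) hr j
  rw [hstep, parity_add, sgnK_trK_lin4_unitK_coDress hr j _ _ _ _ hbU, lin4_smul,
    lin4_add_of_bdd₄ (decays_unitK (sf := sfStep Lc j) (sm := smStep d Lc j) hG) hδK _ _ hbU hbP, lin4_smul]
  simp only [smul_add]
  abel

/-- [folklore] **THE `ε`-MEMBER IS BOUNDED** (entries; `shape_member` ⨾ `bdd_of_locStencil₂` ⨾ `bdd₄_parity ∕ bdd₄_smul ∕ bdd₄_add`). -/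
theorem bdd₄_halfMember (hLc : 1 ≤ Lc) (hr : r ∈ box (d + 1) Lc) (cE cVH cΛ cE₂ cB : ℝ) (Tc : Fin 4 → Fin 4 → Fin 4 → Fin 4 → ℝ)
    {vh₂S : Tab d} (hB : ∃ C δ : ℝ, 0 < δ ∧ LocStencil₂ vh₂S C δ) (ε : ℝ) (j : ℕ) :
    ∃ B : ℝ, ∀ κ u κ' u' x z a b,
      |((1 / 2 : ℝ) • (unitS₂ (sfStep Lc j) (smStep d Lc j) (T2RecAt d Lc (toSite r) cE cVH cΛ cE₂ cB Tc vh₂S (mixFFAt (toSite r) Lc) j)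
          + ε • fun κ u κ' u' => sgnK (trK (unitS₂ (sfStep Lc j) (smStep d Lc j) (T2RecAt d Lc (toSite r) cE cVH cΛ cE₂ cB Tc vh₂S (mixFFAt (toSite r) Lc) j) κ u κ' u')))) κ u κ' u' x z a b| ≤ B := by
  obtain ⟨CT, δT, hδT, hT⟩ := shape_member hLc hr cE cVH cΛ cE₂ cB Tc hB j
  have hbU : ∃ B : ℝ, ∀ κ u κ' u' x z a b,
      |unitS₂ (sfStep Lc j) (smStep d Lc j) (T2RecAt d Lc (toSite r) cE cVH cΛ cE₂ cB Tc vh₂S (mixFFAt (toSite r) Lc) j) κ u κ' u' x z a b| ≤ B :=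
    ⟨CT, bdd_of_locStencil₂ hT hδT.le⟩
  exact bdd₄_smul (1 / 2 : ℝ) (bdd₄_add hbU (bdd₄_smul ε (bdd₄_parity hbU)))

/-- NOT IN PRINT; OUR BOOKKEEPING.  **T-EQ ON THE `ε`-MEMBER OF THE DRESSED COMB TOWER** (every `ε j y ν y′`; in-block root, `1 ≤ Lc`; an1's border data `hBff hBmm hB`):
with `y_j := ½ • (T♮̃_j + ε • P T♮̃_j)`,
`divW (y_{j+1}) y ν y′ = divW (½ • (b♮̃_j + ε • P b♮̃_j)) y ν y′ + (c₄·(Lc^{d+1})⁻¹∕2) • (e3OfK Lc K♮ᴱ_j F₁^{ε} ν y′ + e3OfK Lc K♮ᴱ_j F₂^{ε} ν y′)`,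
`F₁^{ε} κ′ u′ := Σ_{v∈box} divV (κ u ↦ y_j κ u κ′ u′) (Lc•y + toSite v)`, `F₂^{ε} κ u := Σ_v divV (y_j κ u) (Lc•y + toSite v)` — `halfMember_succ_eq`, then leaf-03 g58's
`divW_lin4_comb` on the bounded `y_j` and leaf-06's `divW_add_apply`; NO commutation of `P` with `e3OfK` is used. -/
theorem divW_halfMember_succ_eq (hLc : 1 ≤ Lc) (hr : r ∈ box (d + 1) Lc) (cE cVH cΛ cE₂ cB : ℝ) (Tc : Fin 4 → Fin 4 → Fin 4 → Fin 4 → ℝ)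
    {vh₂S : Tab d} (hBff : ∀ κ u κ' u' x z (α β : Fin (d + 1)), vh₂S κ u κ' u' x z (Sum.inl α) (Sum.inl β) = 0)
    (hBmm : ∀ κ u κ' u' x z (μ ν : Fin (d + 1)), vh₂S κ u κ' u' x z (Sum.inr μ) (Sum.inr ν) = 0)
    (hB : ∃ C δ : ℝ, 0 < δ ∧ LocStencil₂ vh₂S C δ) (ε : ℝ) (j : ℕ)
    (y : Fin (d + 1) → ℤ) (ν : Fin (d + 1)) (y' : Fin (d + 1) → ℤ) :
    divW ((1 / 2 : ℝ) • (unitS₂ (sfStep Lc (j + 1)) (smStep d Lc (j + 1)) (T2RecAt d Lc (toSite r) cE cVH cΛ cE₂ cB Tc vh₂S (mixFFAt (toSite r) Lc) (j + 1))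
          + ε • fun κ u κ' u' => sgnK (trK (unitS₂ (sfStep Lc (j + 1)) (smStep d Lc (j + 1)) (T2RecAt d Lc (toSite r) cE cVH cΛ cE₂ cB Tc vh₂S (mixFFAt (toSite r) Lc) (j + 1)) κ u κ' u')))) y ν y'
      = divW ((1 / 2 : ℝ) • ((fun κ u κ' u' => (cE₂ * (Lc : ℝ) ^ (2 * (d + 1))) • mmRead Lc (K3OfK
            (unitK (sfStep Lc j) (smStep d Lc j) (coDressKBmAt (toSite r) Lc (KInvStep (d := d) Lc j))) Lc
            (unitS (sfStep Lc j) (smStep d Lc j) (SpureRecAt d Lc (toSite r) cE cVH cΛ j)) (unitM (sfStep Lc j) (smStep d Lc j) (M1At d Lc (toSite r) cΛ j))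
            (W2SymOfK (unitK (sfStep Lc j) (smStep d Lc j) (coDressKBmAt (toSite r) Lc (KInvStep (d := d) Lc j))) Lc
              (unitS (sfStep Lc j) (smStep d Lc j) (SpureRecAt d Lc (toSite r) cE cVH cΛ j)) (unitM (sfStep Lc j) (smStep d Lc j) (M1At d Lc (toSite r) cΛ j)) 0
              (unitM₂ (sfStep Lc j) (smStep d Lc j) (M2Of d Lc (mixFFAt (toSite r) Lc) j))) κ u κ' u') + cB • vh₂S κ u κ' u')
          + ε • fun κ u κ' u' => sgnK (trK ((fun κ u κ' u' => (cE₂ * (Lc : ℝ) ^ (2 * (d + 1))) • mmRead Lc (K3OfK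
            (unitK (sfStep Lc j) (smStep d Lc j) (coDressKBmAt (toSite r) Lc (KInvStep (d := d) Lc j))) Lc
            (unitS (sfStep Lc j) (smStep d Lc j) (SpureRecAt d Lc (toSite r) cE cVH cΛ j)) (unitM (sfStep Lc j) (smStep d Lc j) (M1At d Lc (toSite r) cΛ j))
            (W2SymOfK (unitK (sfStep Lc j) (smStep d Lc j) (coDressKBmAt (toSite r) Lc (KInvStep (d := d) Lc j))) Lc
              (unitS (sfStep Lc j) (smStep d Lc j) (SpureRecAt d Lc (toSite r) cE cVH cΛ j)) (unitM (sfStep Lc j) (smStep d Lc j) (M1At d Lc (toSite r) cΛ j)) 0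
              (unitM₂ (sfStep Lc j) (smStep d Lc j) (M2Of d Lc (mixFFAt (toSite r) Lc) j))) κ u κ' u') + cB • vh₂S κ u κ' u') κ u κ' u')))) y ν y'
        + (cE₂ * (Lc : ℝ) ^ (2 * (d + 1)) * ((Lc : ℝ) ^ (d + 1))⁻¹ / 2) •
          (e3OfK Lc (unitK (sfStep Lc j) (smStep d Lc j) (coDressKBmAt (toSite r) Lc (KInvStep (d := d) Lc j)))
              (fun κ' u' => ∑ v ∈ box (d + 1) Lc, divV (fun κ u =>
                ((1 / 2 : ℝ) • (unitS₂ (sfStep Lc j) (smStep d Lc j) (T2RecAt d Lc (toSite r) cE cVH cΛ cE₂ cB Tc vh₂S (mixFFAt (toSite r) Lc) j)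
          + ε • fun κ u κ' u' => sgnK (trK (unitS₂ (sfStep Lc j) (smStep d Lc j) (T2RecAt d Lc (toSite r) cE cVH cΛ cE₂ cB Tc vh₂S (mixFFAt (toSite r) Lc) j) κ u κ' u')))) κ u κ' u')
                ((Lc : ℤ) • y + toSite v)) ν y'
            + e3OfK Lc (unitK (sfStep Lc j) (smStep d Lc j) (coDressKBmAt (toSite r) Lc (KInvStep (d := d) Lc j)))
              (fun κ u => ∑ v ∈ box (d + 1) Lc, divV
                (((1 / 2 : ℝ) • (unitS₂ (sfStep Lc j) (smStep d Lc j) (T2RecAt d Lc (toSite r) cE cVH cΛ cE₂ cB Tc vh₂S (mixFFAt (toSite r) Lc) j)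
          + ε • fun κ u κ' u' => sgnK (trK (unitS₂ (sfStep Lc j) (smStep d Lc j) (T2RecAt d Lc (toSite r) cE cVH cΛ cE₂ cB Tc vh₂S (mixFFAt (toSite r) Lc) j) κ u κ' u')))) κ u)
                ((Lc : ℤ) • y + toSite v)) ν y') := by
  obtain ⟨B, hBy⟩ := bdd₄_halfMember hLc hr cE cVH cΛ cE₂ cB Tc hB ε j
  rw [halfMember_succ_eq hLc hr cE cVH cΛ cE₂ cB Tc hBff hBmm hB ε j, divW_add_apply, divW_lin4_comb hr j _ hBy y ν y']
  exact add_comm _ _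

end Member

/-! ## §2 The `ε`-member's block-summed slot divergences, slaved by a raw table law with parities -/

section Slave

omit [NeZero Lc] in
/-- NOT IN PRINT; OUR BOOKKEEPING.  **THE FIRST-SLOT BLOCK-SUMMED DIVERGENCE OF THE `ε`-MEMBER, SLAVED BY A TABLE LAW WITH PARITIES** (letters: a table `T`, its
first-order partner `S`, block generators `X Y`, a remainder `R`, a Ward constant `cH′ ≠ 0`; the law in the LITERAL shape of D1's `tableLaw_T2RecAt_succ ∕ _zero`; the
commutator word parity-EVEN (`hC`), the remainder parity-ODD (`hR`)): with `y := ½ • (unitS₂ sf sm T + ε • P (unitS₂ sf sm T))`,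
`Σ_{v∈box} divV (κ u ↦ y κ u κ′ u′) (Lc•y + v) = (sf·sm)⁻¹ • unitS sf sm (κ′ u′ ↦ cH′⁻¹ • (((1+ε)∕2) • (S κ′ u′ ∘ X y − X y ∘ S κ′ u′) + ((1−ε)∕2) • R y κ′ u′)) κ′ u′`
— at `ε = 1` NO `R`, at `ε = −1` NO commutator (leaf-06's `boxSum_divV_unitS₂_fst_of_tableLaw` ⨾ §0 ⨾ `parityEven_iff ∕ parityOdd_iff`). -/
theorem boxSum_divV_half_fst_of_tableLaw (sf sm : ℝ) {T : Tab d} {S : Fin (d + 1) → (Fin (d + 1) → ℤ) → MKer (d + 1) (Fib d)}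
    {X : (Fin (d + 1) → ℤ) → MKer (d + 1) (Fib d)} {R : (Fin (d + 1) → ℤ) → Fin (d + 1) → (Fin (d + 1) → ℤ) → MKer (d + 1) (Fib d)}
    {cH' : ℝ} (hcH : cH' ≠ 0)
    (hTL : ∀ (Y : Fin (d + 1) → ℤ) (κ' : Fin (d + 1)) (u' : Fin (d + 1) → ℤ),
      cH' • ∑ v ∈ box (d + 1) Lc, divV (fun κ u => T κ u κ' u') ((Lc : ℤ) • Y + toSite v) = comp (S κ' u') (X Y) - comp (X Y) (S κ' u') + R Y κ' u')
    (hC : ∀ (Y : Fin (d + 1) → ℤ) (κ : Fin (d + 1)) (u : Fin (d + 1) → ℤ),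
      trK (comp (S κ u) (X Y) - comp (X Y) (S κ u)) = sgnK (comp (S κ u) (X Y) - comp (X Y) (S κ u)))
    (hR : ∀ (Y : Fin (d + 1) → ℤ) (κ : Fin (d + 1)) (u : Fin (d + 1) → ℤ), trK (R Y κ u) = -sgnK (R Y κ u))
    (ε : ℝ) (y : Fin (d + 1) → ℤ) (κ' : Fin (d + 1)) (u' : Fin (d + 1) → ℤ) :
    ∑ v ∈ box (d + 1) Lc, divV (fun κ u => ((1 / 2 : ℝ) • (unitS₂ sf sm T
          + ε • fun κ u κ' u' => sgnK (trK (unitS₂ sf sm T κ u κ' u')))) κ u κ' u') ((Lc : ℤ) • y + toSite v)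
      = (sf * sm)⁻¹ • unitS sf sm (fun κ' u' => cH'⁻¹ • ((((1 : ℝ) + ε) / 2) • (comp (S κ' u') (X y) - comp (X y) (S κ' u'))
          + (((1 : ℝ) - ε) / 2) • R y κ' u')) κ' u' := by
  have hPC : ∀ κ u, sgnK (trK (comp (S κ u) (X y) - comp (X y) (S κ u))) = comp (S κ u) (X y) - comp (X y) (S κ u) :=
    fun κ u => (parityEven_iff _).1 (hC y κ u)
  have hPR : ∀ κ u, sgnK (trK (R y κ u)) = -R y κ u := fun κ u => (parityOdd_iff _).1 (hR y κ u)
  rw [boxSum_divV_fst_half, boxSum_divV_unitS₂_fst_of_tableLaw sf sm hcH hTL y κ' u', sgnK_trK_smul, sgnK_trK_unitS]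
  simp only [sgnK_trK_smul, sgnK_trK_add, hPC, hPR]
  funext x z a b
  simp only [Pi.smul_apply, Pi.add_apply, Pi.sub_apply, Pi.neg_apply, smul_eq_mul, unitS_apply]
  ring

omit [NeZero Lc] in
/-- NOT IN PRINT; OUR BOOKKEEPING.  **THE SECOND-SLOT BLOCK-SUMMED DIVERGENCE OF THE `ε`-MEMBER, SLAVED BY THE SECOND-SLOT TABLE LAW WITH PARITIES** (shape of
`tableLaw_T2RecAt_succ'' ∕ _zero''`; letters `S X R″ cH′`, `hC`, `hR″`). -/
theorem boxSum_divV_half_snd_of_tableLaw (sf sm : ℝ) {T : Tab d} {S : Fin (d + 1) → (Fin (d + 1) → ℤ) → MKer (d + 1) (Fib d)}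
    {X : (Fin (d + 1) → ℤ) → MKer (d + 1) (Fib d)} {R'' : (Fin (d + 1) → ℤ) → Fin (d + 1) → (Fin (d + 1) → ℤ) → MKer (d + 1) (Fib d)}
    {cH' : ℝ} (hcH : cH' ≠ 0)
    (hTL'' : ∀ (Y : Fin (d + 1) → ℤ) (κ : Fin (d + 1)) (u : Fin (d + 1) → ℤ),
      cH' • ∑ v ∈ box (d + 1) Lc, divV (T κ u) ((Lc : ℤ) • Y + toSite v) = comp (S κ u) (X Y) - comp (X Y) (S κ u) + R'' Y κ u)
    (hC : ∀ (Y : Fin (d + 1) → ℤ) (κ : Fin (d + 1)) (u : Fin (d + 1) → ℤ),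
      trK (comp (S κ u) (X Y) - comp (X Y) (S κ u)) = sgnK (comp (S κ u) (X Y) - comp (X Y) (S κ u)))
    (hR'' : ∀ (Y : Fin (d + 1) → ℤ) (κ : Fin (d + 1)) (u : Fin (d + 1) → ℤ), trK (R'' Y κ u) = -sgnK (R'' Y κ u))
    (ε : ℝ) (y : Fin (d + 1) → ℤ) (κ : Fin (d + 1)) (u : Fin (d + 1) → ℤ) :
    ∑ v ∈ box (d + 1) Lc, divV (((1 / 2 : ℝ) • (unitS₂ sf sm T
          + ε • fun κ u κ' u' => sgnK (trK (unitS₂ sf sm T κ u κ' u')))) κ u) ((Lc : ℤ) • y + toSite v)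
      = (sf * sm)⁻¹ • unitS sf sm (fun κ u => cH'⁻¹ • ((((1 : ℝ) + ε) / 2) • (comp (S κ u) (X y) - comp (X y) (S κ u))
          + (((1 : ℝ) - ε) / 2) • R'' y κ u)) κ u := by
  have hPC : ∀ κ u, sgnK (trK (comp (S κ u) (X y) - comp (X y) (S κ u))) = comp (S κ u) (X y) - comp (X y) (S κ u) :=
    fun κ u => (parityEven_iff _).1 (hC y κ u)
  have hPR : ∀ κ u, sgnK (trK (R'' y κ u)) = -R'' y κ u := fun κ u => (parityOdd_iff _).1 (hR'' y κ u)
  rw [boxSum_divV_snd_half, boxSum_divV_unitS₂_snd_of_tableLaw sf sm hcH hTL'' y κ u, sgnK_trK_smul, sgnK_trK_unitS]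
  simp only [sgnK_trK_smul, sgnK_trK_add, hPC, hPR]
  funext x z a b
  simp only [Pi.smul_apply, Pi.add_apply, Pi.sub_apply, Pi.neg_apply, smul_eq_mul, unitS_apply]
  ring

end Slave

end Summit.QuantumFields.BalabanUV.Beta.GAN24.HalfMemberSlavedDivergence

end
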